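import Mathlib.NumberTheory.Cyclotomic.CyclotomicCharacter
import Mathlib.NumberTheory.LegendreSymbol.ZModChar
import Mathlib.NumberTheory.GaussSum
import Mathlib.NumberTheory.LegendreSymbol.QuadraticChar.Basic
import Mathlib.Analysis.SpecialFunctions.Complex.CircleAddChar
import Mathlib.RingTheory.RootsOfUnity.Complex
import Mathlib.RingTheory.RootsOfUnity.AlgebraicallyClosed
import HarnessLib

/-!
# [Liu2021, Thm 4.18 (3), proof l. 2272–2288] — the number-theoretic core, step L2 (cyclotomic):
# an automorphism of `ℂ` fixes `√−1`, `√2`, `√−2` iff its mod-`8` cyclotomic character lies in the corresponding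
# index-two subgroup of `(ℤ/8)^×`

Topic `NumberTheory/Automorphic/Liu2021`; namespace `Literature.NumberTheory.Automorphic.Liu2021`.  Cell `hodgecm-mathlib` (D-0151),
row III-11 (G2): second of the three number-theoretic lemmas L3 → L2 → L1 behind the printed reduction of [Liu2021] Thm. 4.18 (3)
(A-p11 PREP-III11; director g1 03:21:04Z (b)).  THEOREMS ONLY over Mathlib (no definition, no named fact, no instance; debt 0).
HC_CM is proved only modulo the 7 printed citations until rung 0 closes.

THE PRINT (`FJcycle.tex` l. 2272–2288, print pp. 53–54), VERBATIM: «it suffices to show that for every rational prime `p`, the image of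
`Gal(ℂ/M_μ)` under the `p`-adic cyclotomic character `χ_p : Gal(ℂ/ℚ) → ℤ_p^×` is contained in `ℤ_p^× ∩ Nm_{E_𝔭/F_𝔭}E_𝔭^×` […] Put
`U_{E/F} := ℤ_p^× ∩ Nm_{E/F}E^×`, which we may assume a subgroup of `ℤ_p^×` of index `2`. Denote by `M_{E/F} ⊆ ℂ` the subfield corresponding
to the kernel of the composite homomorphism `Gal(ℂ/ℚ) → ℤ_p^× → ℤ_p^×/U_{E/F}`, which is a quadratic field. Thus, our goal is to show that
`M_{E/F}` is contained in `M_μ`.» and (l. 2283) «Suppose that `M_{E/F} = ℚ(√−1)`. Then `U_{E/F} = 1 + 4ℤ_2`», (l. 2285) «Suppose that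
`M_{E/F} = ℚ(√2)`. Then `U_{E/F} = ±1 + 8ℤ_2`», (l. 2287) «Suppose that `M_{E/F} = ℚ(√−2)`. Then `U_{E/F} = ±1 + 2 + 8ℤ_2`».

WHAT THIS FILE PROVES — the three displayed dictionary entries `M_{E/F} ↔ U_{E/F}` between quadratic subfields of `ℚ(ζ_8) ⊂ ℂ` and
index-two subgroups of `(ℤ/8)^×` (hence of `ℤ_2^×`), as statements about an arbitrary automorphism `σ` of `ℂ` and Mathlib's modular
cyclotomic character `χ̄_n(σ) ∈ (ℤ/n)^×` (`σ ζ = ζ^{χ̄_n(σ)}` for every `n`-th root of unity `ζ`; the `p`-adic character `χ_p` reduces to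
`χ̄_{p^k}` by Mathlib's `cyclotomicCharacter.toZModPow`):
* `apply_eq_pow_val_modularCyclotomicCharacter` — `σ s = s^{χ̄_n(σ)}` for `s ∈ ℂ` with `s^n = 1`; `…_val_coprime`: `χ̄_n(σ)` is prime to `n`;
* `apply_eq_self_iff_of_sq_eq_neg_one` — **`σ(√−1) = √−1 ⟺ χ̄_4(σ) = 1`** («`U_{E/F} = 1 + 4ℤ_2`»), for every `s` with `s² = −1`;
* `apply_eq_self_iff_of_sq_eq_two` — **`σ(√2) = √2 ⟺ χ₈(χ̄_8(σ)) = 1`**, i.e. `χ̄_8(σ) ∈ {±1}` («`U_{E/F} = ±1 + 8ℤ_2`»; Mathlib's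
  `ZMod.χ₈`), via `√2 = ζ_8 + ζ_8^7`;
* `apply_eq_self_iff_of_sq_eq_neg_two` — **`σ(√−2) = √−2 ⟺ χ₈'(χ̄_8(σ)) = 1`**, i.e. `χ̄_8(σ) ∈ {1, 3}` («`U_{E/F} = ±1 + 2 + 8ℤ_2`»;
  Mathlib's `ZMod.χ₈'`), via `√−2 = ζ_8 + ζ_8^3`.
With L3 (`Thm418MuFieldContainsNormField`: `√c ∈ M_μ`, `c = μ(−1)·2^{f v_F(u)}`) these give, for `σ ∈ Aut(ℂ/M_μ)`, `χ̄_8(σ) ∈ U_{E/F} mod 8`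
in each of Liu's three dyadic cases;
* `apply_eq_self_iff_of_sq_eq_quadraticChar_mul_prime` — the odd-`p` entry: **`σ(√p*) = √p* ⟺ χ̄_p(σ)` is a square mod `p`**
  (`p* = χ₄(p)·p`; «`M_{E/F} = ℚ(√p)`» resp. «`ℚ(√−p)`», l. 2276/2278), by the Gauss sum `g² = p*`, `σ g = (χ̄_p(σ)/p)·g`.
L1 (the local norm groups themselves) is not here.

## References
* [Liu2021] Y. Liu, *Fourier–Jacobi cycles and arithmetic relative trace formula*, Camb. J. Math. 9 (2021), 1–147: proof of Thm. 4.18 (3),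
  `FJcycle.tex` l. 2272–2288 (print pp. 53–54).
-/

set_option autoImplicit false

noncomputable section

open Complex

namespace Literature.NumberTheory.Automorphic.Liu2021

/-! ## §1 `σ s = s^{χ̄_n(σ)}` for roots of unity `s ∈ ℂ` -/

/-- **An automorphism of `ℂ` acts on an `n`-th root of unity `s` by `s ↦ s^{χ̄_n(σ)}`** — Mathlib's `modularCyclotomicCharacter.spec`
for the element `s` (given `s^n = 1`) rather than a member of `rootsOfUnity n ℂ`.  (Liu: «the `p`-adic cyclotomic character
`χ_p : Gal(ℂ/ℚ) → ℤ_p^×`», reduced mod `p^k`.) [cite: Liu2021, proof of Thm. 4.18 (3), l. 2272] -/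
theorem apply_eq_pow_val_modularCyclotomicCharacter (σ : ℂ ≃+* ℂ) {n : ℕ} [NeZero n] (hn : Nat.card (rootsOfUnity n ℂ) = n)
    {s : ℂ} (hs : s ^ n = 1) :
    σ s = s ^ ((modularCyclotomicCharacter ℂ hn σ : (ZMod n)ˣ) : ZMod n).val := by
  have h := modularCyclotomicCharacter.spec ℂ hn σ (t := (rootsOfUnity.mkOfPowEq s hs : ℂˣ)) (rootsOfUnity.mkOfPowEq s hs).2
  rwa [rootsOfUnity.coe_mkOfPowEq] at h

/-- `χ̄_n(σ)` is a unit of `ℤ/n`: its representative in `{0, …, n−1}` is prime to `n`. [cite: Liu2021, proof of Thm. 4.18 (3), l. 2272] -/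
theorem val_modularCyclotomicCharacter_coprime (σ : ℂ ≃+* ℂ) {n : ℕ} [NeZero n] (hn : Nat.card (rootsOfUnity n ℂ) = n) :
    Nat.Coprime ((modularCyclotomicCharacter ℂ hn σ : (ZMod n)ˣ) : ZMod n).val n :=
  ZMod.val_coe_unit_coprime _

/-- If `σ` multiplies one square root of `c` by `ε`, it multiplies the other one by `ε` as well: for `s² = t²`, `σ t = ε t` ⇒ `σ s = ε s`.
[cite: Liu2021, proof of Thm. 4.18 (3), l. 2272–2288] -/
theorem apply_eq_mul_of_sq_eq_sq (σ : ℂ ≃+* ℂ) {s t ε : ℂ} (hst : s ^ 2 = t ^ 2) (ht : σ t = ε * t) : σ s = ε * s := by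
  rcases sq_eq_sq_iff_eq_or_eq_neg.1 hst with rfl | rfl
  · exact ht
  · rw [map_neg, ht, mul_neg]

/-- `ε s = s` with `s ≠ 0` forces `ε = 1`; so `σ s = ε s` gives `σ s = s ↔ ε = 1`. [cite: Liu2021, proof of Thm. 4.18 (3), l. 2272–2288] -/
theorem apply_eq_self_iff_of_apply_eq_mul (σ : ℂ ≃+* ℂ) {s ε : ℂ} (hs : s ≠ 0) (h : σ s = ε * s) : σ s = s ↔ ε = 1 := by
  rw [h]
  constructor
  · intro h1
    exact mul_right_cancel₀ hs (by rw [h1, one_mul])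
  · rintro rfl
    rw [one_mul]

/-! ## §2 `M_{E/F} = ℚ(√−1)` ↔ `U_{E/F} = 1 + 4ℤ_2` -/

/-- **«`M_{E/F} = ℚ(√−1)` … `U_{E/F} = 1 + 4ℤ_2`»**: an automorphism `σ` of `ℂ` fixes a square root `s` of `−1` iff its mod-`4` cyclotomic
character is trivial, `χ̄_4(σ) = 1` (i.e. `χ_2(σ) ≡ 1 mod 4`): `s` is a primitive `4`-th root of unity, `σ s = s^{χ̄_4(σ)}` with
`χ̄_4(σ) ∈ {1, 3}`, and `s³ = −s ≠ s`. [cite: Liu2021, proof of Thm. 4.18 (3), l. 2283 («U_{E/F} = 1+4ℤ_2»)] -/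
theorem apply_eq_self_iff_of_sq_eq_neg_one (σ : ℂ ≃+* ℂ) (hn : Nat.card (rootsOfUnity 4 ℂ) = 4) {s : ℂ} (hs : s ^ 2 = -1) :
    σ s = s ↔ (modularCyclotomicCharacter ℂ hn σ : (ZMod 4)ˣ) = 1 := by
  set a : ZMod 4 := ((modularCyclotomicCharacter ℂ hn σ : (ZMod 4)ˣ) : ZMod 4) with ha
  have hs4 : s ^ 4 = 1 := by
    rw [show (4 : ℕ) = 2 * 2 by norm_num, pow_mul, hs]
    norm_num
  have hs0 : s ≠ 0 := by
    rintro rfl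
    norm_num at hs
  have hσ : σ s = s ^ a.val := apply_eq_pow_val_modularCyclotomicCharacter σ hn hs4
  have hcop : Nat.Coprime a.val 4 := val_modularCyclotomicCharacter_coprime σ hn
  have hlt : a.val < 4 := ZMod.val_lt a
  -- `a.val ∈ {1, 3}`
  have hcases : a.val = 1 ∨ a.val = 3 := by
    interval_cases h : a.val <;> simp_all (config := { decide := true })
  rw [← Units.val_eq_one, ← ha]
  rcases hcases with h1 | h3
  · rw [h1, pow_one] at hσ
    exact ⟨fun _ => (ZMod.val_eq_one (by norm_num : 1 < 4) a).1 h1, fun _ => hσ⟩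
  · have hneg : σ s = -1 * s := by
      rw [hσ, h3, pow_succ, hs]
    rw [apply_eq_self_iff_of_apply_eq_mul σ hs0 hneg]
    constructor
    · intro h
      norm_num at h
    · intro h
      rw [← ZMod.val_eq_one (by norm_num : 1 < 4) a] at h
      omega

/-! ## §3 `M_{E/F} = ℚ(√2)` ↔ `U_{E/F} = ±1 + 8ℤ_2` and `M_{E/F} = ℚ(√−2)` ↔ `U_{E/F} = ±1 + 2 + 8ℤ_2` -/

/-- The primitive `8`-th root of unity `ζ = e^{2πi/8}`: `ζ⁸ = 1`, `ζ⁴ = −1`, and the two square roots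
`(ζ + ζ⁷)² = 2`, `(ζ + ζ³)² = −2`. [cite: Liu2021, proof of Thm. 4.18 (3), l. 2285–2287] -/
theorem zeta_eight_facts :
    (exp (2 * Real.pi * I / 8)) ^ 8 = 1 ∧ (exp (2 * Real.pi * I / 8)) ^ 4 = -1 ∧
      (exp (2 * Real.pi * I / 8) + (exp (2 * Real.pi * I / 8)) ^ 7) ^ 2 = 2 ∧
      (exp (2 * Real.pi * I / 8) + (exp (2 * Real.pi * I / 8)) ^ 3) ^ 2 = -2 := by
  set ζ := exp (2 * Real.pi * I / 8) with hζ
  have hprim : IsPrimitiveRoot ζ 8 := by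
    rw [hζ]
    exact_mod_cast Complex.isPrimitiveRoot_exp 8 (by norm_num)
  have h8 : ζ ^ 8 = 1 := hprim.pow_eq_one
  have h4 : ζ ^ 4 = -1 := (hprim.pow (by norm_num : 0 < 8) (show 8 = 4 * 2 by norm_num)).eq_neg_one_of_two_right
  refine ⟨h8, h4, ?_, ?_⟩
  · have : (ζ + ζ ^ 7) ^ 2 = ζ ^ 2 * (1 + ζ ^ 4 * ζ ^ 8) + 2 * ζ ^ 8 := by ring
    rw [this, h4, h8]
    ring
  · have : (ζ + ζ ^ 3) ^ 2 = ζ ^ 2 * (1 + ζ ^ 4) + 2 * ζ ^ 4 := by ring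
    rw [this, h4]
    ring

/-- Reduction of exponents mod `8` for `ζ⁸ = 1`. [folklore] -/
private theorem pow_eq_pow_mod_eight {ζ : ℂ} (h8 : ζ ^ 8 = 1) (m : ℕ) : ζ ^ m = ζ ^ (m % 8) := by
  conv_lhs => rw [← Nat.div_add_mod m 8, pow_add, pow_mul, h8, one_pow, one_mul]

/-- **The action of `σ` on `√2 = ζ + ζ⁷` and on `√−2 = ζ + ζ³`**: with `a = χ̄_8(σ) ∈ {1, 3, 5, 7}`, `σ(ζ + ζ⁷) = χ₈(a)·(ζ + ζ⁷)` and
`σ(ζ + ζ³) = χ₈'(a)·(ζ + ζ³)` (the four cases `a = 1, 3, 5, 7`, using `ζ⁴ = −1`). [cite: Liu2021, proof of Thm. 4.18 (3), l. 2285–2287] -/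
theorem apply_sqrt_two_and_sqrt_neg_two (σ : ℂ ≃+* ℂ) (hn : Nat.card (rootsOfUnity 8 ℂ) = 8) :
    σ (exp (2 * Real.pi * I / 8) + (exp (2 * Real.pi * I / 8)) ^ 7) =
        (ZMod.χ₈ ((modularCyclotomicCharacter ℂ hn σ : (ZMod 8)ˣ) : ZMod 8) : ℂ) *
          (exp (2 * Real.pi * I / 8) + (exp (2 * Real.pi * I / 8)) ^ 7) ∧
      σ (exp (2 * Real.pi * I / 8) + (exp (2 * Real.pi * I / 8)) ^ 3) =
        (ZMod.χ₈' ((modularCyclotomicCharacter ℂ hn σ : (ZMod 8)ˣ) : ZMod 8) : ℂ) *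
          (exp (2 * Real.pi * I / 8) + (exp (2 * Real.pi * I / 8)) ^ 3) := by
  set ζ := exp (2 * Real.pi * I / 8) with hζ
  obtain ⟨h8, h4, -, -⟩ := zeta_eight_facts
  rw [← hζ] at h8 h4
  set a : ZMod 8 := ((modularCyclotomicCharacter ℂ hn σ : (ZMod 8)ˣ) : ZMod 8) with ha
  have hσ : σ ζ = ζ ^ a.val := apply_eq_pow_val_modularCyclotomicCharacter σ hn h8
  have hcop : Nat.Coprime a.val 8 := val_modularCyclotomicCharacter_coprime σ hn
  have hlt : a.val < 8 := ZMod.val_lt a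
  have hcases : a.val = 1 ∨ a.val = 3 ∨ a.val = 5 ∨ a.val = 7 := by
    interval_cases h : a.val <;> simp_all (config := { decide := true })
  -- `σ(ζ + ζ^k) = ζ^m + ζ^{mk mod 8}` and `χ(a) = χ(m)` when `a.val = m`
  have key : ∀ m k : ℕ, a.val = m → σ (ζ + ζ ^ k) = ζ ^ m + ζ ^ (m * k % 8) := by
    rintro m k rfl
    rw [map_add, map_pow, hσ, ← pow_mul, pow_eq_pow_mod_eight h8 (a.val * k)]
  have keyχ : ∀ m : ℕ, a.val = m → ZMod.χ₈ a = ZMod.χ₈ (m : ZMod 8) ∧ ZMod.χ₈' a = ZMod.χ₈' (m : ZMod 8) := by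
    rintro m rfl
    rw [ZMod.natCast_zmod_val]
    exact ⟨rfl, rfl⟩
  -- the values of `χ₈`, `χ₈'` on `1, 3, 5, 7`
  have v1 : ZMod.χ₈ ((1 : ℕ) : ZMod 8) = 1 ∧ ZMod.χ₈' ((1 : ℕ) : ZMod 8) = 1 := by decide
  have v3 : ZMod.χ₈ ((3 : ℕ) : ZMod 8) = -1 ∧ ZMod.χ₈' ((3 : ℕ) : ZMod 8) = 1 := by decide
  have v5 : ZMod.χ₈ ((5 : ℕ) : ZMod 8) = -1 ∧ ZMod.χ₈' ((5 : ℕ) : ZMod 8) = -1 := by decide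
  have v7 : ZMod.χ₈ ((7 : ℕ) : ZMod 8) = 1 ∧ ZMod.χ₈' ((7 : ℕ) : ZMod 8) = -1 := by decide
  -- powers of `ζ` reduced with `ζ⁴ = −1`
  have h5 : ζ ^ 5 = -ζ := by rw [show (5 : ℕ) = 4 + 1 by norm_num, pow_add, h4, pow_one, neg_one_mul]
  have h7 : ζ ^ 7 = -ζ ^ 3 := by rw [show (7 : ℕ) = 4 + 3 by norm_num, pow_add, h4, neg_one_mul]
  rcases hcases with h | h | h | h <;> obtain ⟨c8, c8'⟩ := keyχ _ h <;>
    rw [key _ 7 h, key _ 3 h, c8, c8'] <;> simp only [Nat.reduceMul, Nat.reduceMod]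
  · rw [v1.1, v1.2, pow_one, Int.cast_one, one_mul, one_mul]
    exact ⟨rfl, rfl⟩
  · rw [v3.1, v3.2, pow_one, Int.cast_neg, Int.cast_one, one_mul, h5, h7]
    exact ⟨by ring, by ring⟩
  · rw [v5.1, v5.2, Int.cast_neg, Int.cast_one, h5, h7]
    exact ⟨by ring, by ring⟩
  · rw [v7.1, v7.2, pow_one, Int.cast_neg, Int.cast_one, one_mul, h5, h7]
    exact ⟨by ring, by ring⟩

/-- **«`M_{E/F} = ℚ(√2)` … `U_{E/F} = ±1 + 8ℤ_2`»**: `σ` fixes a square root `s` of `2` iff `χ₈(χ̄_8(σ)) = 1`, i.e. `χ̄_8(σ) ≡ ±1 mod 8`.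
[cite: Liu2021, proof of Thm. 4.18 (3), l. 2285] -/
theorem apply_eq_self_iff_of_sq_eq_two (σ : ℂ ≃+* ℂ) (hn : Nat.card (rootsOfUnity 8 ℂ) = 8) {s : ℂ} (hs : s ^ 2 = 2) :
    σ s = s ↔ ZMod.χ₈ ((modularCyclotomicCharacter ℂ hn σ : (ZMod 8)ˣ) : ZMod 8) = 1 := by
  obtain ⟨-, -, ht, -⟩ := zeta_eight_facts
  have hs0 : s ≠ 0 := by
    rintro rfl
    norm_num at hs
  have h := apply_eq_mul_of_sq_eq_sq σ (hs.trans ht.symm) (apply_sqrt_two_and_sqrt_neg_two σ hn).1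
  rw [apply_eq_self_iff_of_apply_eq_mul σ hs0 h]
  exact_mod_cast Iff.rfl

/-- **«`M_{E/F} = ℚ(√−2)` … `U_{E/F} = ±1 + 2 + 8ℤ_2`»**: `σ` fixes a square root `s` of `−2` iff `χ₈'(χ̄_8(σ)) = 1`, i.e.
`χ̄_8(σ) ≡ 1, 3 mod 8`. [cite: Liu2021, proof of Thm. 4.18 (3), l. 2287] -/
theorem apply_eq_self_iff_of_sq_eq_neg_two (σ : ℂ ≃+* ℂ) (hn : Nat.card (rootsOfUnity 8 ℂ) = 8) {s : ℂ} (hs : s ^ 2 = -2) :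
    σ s = s ↔ ZMod.χ₈' ((modularCyclotomicCharacter ℂ hn σ : (ZMod 8)ˣ) : ZMod 8) = 1 := by
  obtain ⟨-, -, -, ht⟩ := zeta_eight_facts
  have hs0 : s ≠ 0 := by
    rintro rfl
    norm_num at hs
  have h := apply_eq_mul_of_sq_eq_sq σ (hs.trans ht.symm) (apply_sqrt_two_and_sqrt_neg_two σ hn).2
  rw [apply_eq_self_iff_of_apply_eq_mul σ hs0 h]
  exact_mod_cast Iff.rfl

/-! ## §4 The odd prime: `M_{E/F} = ℚ(√p*)`, `p* = (−1)^{(p−1)/2} p`, ↔ the squares of `(ℤ/p)^×` -/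

/-- **«`M_{E/F} = ℚ(√p)` if `−1` is a quadratic residue modulo `p`, `ℚ(√−p)` if not» — both are `ℚ(√p*)`, `p* = χ₄(p)·p`, and `σ` fixes
`√p*` iff `χ̄_p(σ)` is a SQUARE mod `p`** (l. 2274–2278; the classical Gauss-sum computation: `g = ∑_a (a/p) ζ_p^a` has `g² = p*` and
`σ g = (χ̄_p(σ)/p) g`, because `σ ζ_p = ζ_p^{χ̄_p(σ)}` turns `g` into the Gauss sum of the shifted additive character).  Mathlib supplies
`gaussSum_sq`, `gaussSum_mulShift`, `ZMod.stdAddChar`, `quadraticChar_neg_one`. [cite: Liu2021, proof of Thm. 4.18 (3), l. 2274–2278] -/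
theorem apply_eq_self_iff_of_sq_eq_quadraticChar_mul_prime (p : ℕ) [Fact p.Prime] [NeZero p] (hp : p ≠ 2) (σ : ℂ ≃+* ℂ)
    (hn : Nat.card (rootsOfUnity p ℂ) = p) {s : ℂ} (hs : s ^ 2 = (ZMod.χ₄ p : ℂ) * p) :
    σ s = s ↔ IsSquare ((modularCyclotomicCharacter ℂ hn σ : (ZMod p)ˣ) : ZMod p) := by
  classical
  set χ : MulChar (ZMod p) ℂ := (quadraticChar (ZMod p)).ringHomComp (Int.castRingHom ℂ) with hχdef
  set ψ : AddChar (ZMod p) ℂ := ZMod.stdAddChar with hψdef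
  set u : (ZMod p)ˣ := modularCyclotomicCharacter ℂ hn σ with hu
  have hF : ringChar (ZMod p) ≠ 2 := by rwa [ZMod.ringChar_zmod_n]
  have hne : χ ≠ 1 := (MulChar.ringHomComp_ne_one_iff Int.cast_injective).2 (quadraticChar_ne_one hF)
  have hquad : χ.IsQuadratic := (quadraticChar_isQuadratic (ZMod p)).comp _
  have hprim : ψ.IsPrimitive := ZMod.isPrimitive_stdAddChar p
  -- `σ` fixes the values `0, ±1` of `χ` and moves `ψ` to `ψ(u ·)`
  have hσχ : ∀ a : ZMod p, σ (χ a) = χ a := fun a => by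
    rw [hχdef, MulChar.ringHomComp_apply]
    exact map_intCast σ _
  have hψp : ∀ a : ZMod p, ψ a ^ p = 1 := fun a => by
    rw [← AddChar.map_nsmul_eq_pow, nsmul_eq_mul, ZMod.natCast_self, zero_mul, AddChar.map_zero_eq_one]
  have hσψ : ∀ a : ZMod p, σ (ψ a) = ψ ((u : ZMod p) * a) := fun a => by
    rw [apply_eq_pow_val_modularCyclotomicCharacter σ hn (hψp a), ← AddChar.map_nsmul_eq_pow, nsmul_eq_mul,
      ZMod.natCast_zmod_val]
  -- `χ(u) = ±1`
  have hχu : χ u * χ u = 1 := by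
    rcases hquad u with h0 | h1 | h1
    · exact absurd h0 (u.isUnit.map χ).ne_zero
    · rw [h1, one_mul]
    · rw [h1]; norm_num
  -- `σ g = χ(u) g`
  have hσg : σ (gaussSum χ ψ) = χ u * gaussSum χ ψ := by
    have h1 : σ (gaussSum χ ψ) = gaussSum χ (ψ.mulShift u) := by
      rw [gaussSum, gaussSum, map_sum]
      refine Finset.sum_congr rfl fun a _ => ?_
      rw [map_mul, hσχ, hσψ, AddChar.mulShift_apply]
    rw [h1, ← gaussSum_mulShift χ ψ u, ← mul_assoc, hχu, one_mul]
  -- `g² = χ(−1) p = p*`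
  have hg2 : gaussSum χ ψ ^ 2 = (ZMod.χ₄ p : ℂ) * p := by
    rw [gaussSum_sq hne hquad hprim, ZMod.card, hχdef, MulChar.ringHomComp_apply, quadraticChar_neg_one hF, ZMod.card]
    rfl
  have hs0 : s ≠ 0 := by
    intro h0
    rw [h0, zero_pow two_ne_zero] at hs
    have hodd : p % 2 = 1 := (Fact.out : p.Prime).mod_two_eq_one_iff_ne_two.2 hp
    have hχ4 : (ZMod.χ₄ p : ℤ) ≠ 0 := by
      rw [ZMod.χ₄_nat_eq_if_mod_four, if_neg (by omega)]
      split_ifs <;> decide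
    exact mul_ne_zero (Int.cast_ne_zero.2 hχ4) (Nat.cast_ne_zero.2 (NeZero.ne p)) hs.symm
  have h := apply_eq_mul_of_sq_eq_sq σ (hs.trans hg2.symm) hσg
  rw [apply_eq_self_iff_of_apply_eq_mul σ hs0 h, hχdef, MulChar.ringHomComp_apply]
  change ((quadraticChar (ZMod p) (u : ZMod p) : ℤ) : ℂ) = 1 ↔ _
  rw [← quadraticChar_one_iff_isSquare u.ne_zero]
  exact_mod_cast Iff.rfl

end Literature.NumberTheory.Automorphic.Liu2021

end
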